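import Literature.MathematicalPhysics.QuantumFieldTheory.Balaban1983to89.B9Eq373DerivativeRemainderL2

/-!
# `Balaban1983to89.B9Eq3100LeibnizCommutatorCurl` — T. Bałaban, *Propagators for lattice gauge theories in a background field*, Commun. Math.
# Phys. **99** (1985) 389–434 [Balaban1985BackgroundPropagators] (3.100) p. 413 with p. 414 l. 1–3, (3.88) p. 409 and (3.4) p. 391: **THE LEIBNIZ
# (PLAIN COMMUTATOR) LETTERS OF THE COVARIANT CURL `D_U` WITH A SLOWLY VARYING FUNCTION** — `[h, D_U]` IS the multiplication by the bond
# increments of `h` on the two transported edges of each plaquette, `[h,[h, D_U]]` by their SQUARES; on the chain's weighted `L²` carriers: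
# `‖h·D_UA − D_U(h·A)‖ ≤ 4√d·‖c‖θM_T·‖A‖`, `Σ_j ‖[h_j, D_U]A‖² ≤ 8d(‖c‖M_T)²Θ₂‖A‖²`, `‖Σ_j [h_j,[h_j, D_U]]A‖ ≤ 4√d·‖c‖M_TΘ₂·‖A‖` and
# `‖D_UA‖ ≤ 4√d·‖c‖(1+M_T)‖A‖` for ANY scalar `c` (the `η`-readings at `c = η⁻¹` — single commutator and `a₁` `η`-free, the PRODUCT `t₁k₁` `η`-free —
# are the sibling `B9Eq3100LeibnizCommutatorEtaFree`'s) — route R2′ STEP B8′ (S-P7 «IMS assembly»), instance-ledger rows L3 ∕ L6 ∕ L7 for the letter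
# `T₁ = D_U` (curl) of `t4/ROUTES-NE9.md` v13.30

statement-level skeleton of published theorems with citation tags; proofs where landed; nothing here is a claim about the Yang–Mills mass gap

CITATION HEADER (lean-in-tree rule).  Audit cell `pub-balaban`, sub-cell `t4`, BINDER row NE9; filed by NE9 formalisation-swarm LEAF PROVER 04
(`b2b-balaban-t4-ne9-formalise-leaf-04`, gen 76), the lineage of `B9Eq373DerivativeRemainderL2`'s consumers on the `R`-letter side, as the ADDITIVE
twin of NE9 leaf-05's conjugation letters `B9Eq3101ConjugationLetters` (`e^{κχ}D e^{−κχ} − D`, sites → bonds) for the CURL (bonds → plaquettes), in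
the letters NE9 leaf-01's two-space IMS identity `B9Eq387QuadraticPartitionIMS.sum_localised_le_norm_sq_add` consumes (`ad_j T = χ_E^j T − T χ_S^j`,
`K = Σ_j ad_j(ad_j T)`, `Σ_j ‖(ad_j T)x‖²`) and the NE9 crux-ideation seat's kernel 7 `lens1-NE9IMSAssembly` (t4-ne9-idea-1 gen 92; port
`B9Eq387IMSAssembly`, leaf-01) prices (`t_i`, `k_i`, `a_i` — only the PRODUCT `t_ik_i` and `a_i` enter its mass constant).  Source READ by this seat in
the held text `paper:balaban1985-cmp99-background-propagators` (journal page = PDF page + 388): p. 391 (3.4), p. 409 (3.88), pp. 413–414 (3.100)–(3.101).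

THE PRINT (verbatim).  p. 413, (3.100): *«For covariant derivatives we have (D_μ h A_ν)(x) = h(x)(D_μ A_ν)(x) + (∂_μ h)(x)R(U(x, x + ηe_μ))A_ν(x + ηe_μ),
similarly for adjoint derivatives, hence the commutators [D*D, h] and [DD*, h]»* (p. 414 l. 1–3) *«are first order differential operators with
coefficients determined by derivatives of the function h. They are of the order O(M⁻¹), or O(M⁻²), if considered on a proper scale.»*; p. 409,
(3.88): *«(Δ′_a hλ)(x) = h(x)(Δ′_aλ)(x) − Σ_{b∋x}(∂h)(b)(Dλ)(b) + (Δh)(x)λ(x) = h(x)(Δ′_aλ)(x) − (K(h)λ)(x)»*; p. 391, (3.4): the covariant curl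
`(DA)(p_{μν}(x)) = (D_μA_ν)(x) − (D_νA_μ)(x)`, `(D_μA_ν)(x) = η⁻¹(R(U(x, x+ηe_μ))A_ν(x+ηe_μ) − A_ν(x))`.

WHY (route R2′ STEP B8′ «Tier P by discrete IMS localisation», sub-step S-P7, `t4/ROUTES-NE9.md` v13.29 (ii)–(iii) and the INSTANCE LEDGER v13.30
rows L3 ∕ L6 ∕ L7).  Kernel 7's strong-coercivity assembly needs, for the local letter `T₁ = D_U` (curl) and a quadratic partition `Σ_j χ_j² = 1`
sampled at ONE site per bond ∕ plaquette: the single commutators `ad_j D_U` (row L6: «exact Leibniz … MULTIPLICATION letters by `c·(χ_j(b′) − χ_j(b))·R`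
over one lattice step», listed ✗ NOT TYPED), the double-commutator sum `K₁ = Σ_j ad_j ad_j D_U` with the letter `k₁` and the PRODUCT `t₁k₁` (row L7,
✗: «`k_1 ≤ O(√d)·η⁻¹(ℓ_χη)²·N` so `t_1k_1 ≤ O(d)·N·ℓ_χ²` — the `η⁻¹` of L3 is CANCELLED INSIDE THE PRODUCT (kernel 7's design: no Young)»), and the
first-order square `a₁ : Σ_j ‖ad_j D_U x‖² ≤ a₁‖x‖²`.  This file TYPES those rows for the tree's curl: the identities are (3.100) summed over the
two transported edges of `∂p`, the sizes follow from `B9Eq373DerivativeRemainderL2.norm_plaq_le_of_edge_bound` (a bond lies on `≤ 4d` plaquette edges).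

WHAT IS PROVED (sorry-free; proof lane — no `def`, no `Prop` placeholder; [folklore] Leibniz rule + finite sums; nothing of [B9] asserted).
* §1 IDENTITIES at function level (any commutative scalar ring, any scalar site function `σ`, the bond ∕ plaquette multiplications sample `σ` at the base
  point `b₋ = bpos b`, `p.1`): **`comm_covCurl_apply`** — (3.100) for the curl: `σ(x)·(DA)(p_{μν}(x)) − (D(σ̃A))(p_{μν}(x)) =
  c(σ(x) − σ(x+e_μ))·R(x,μ)A_ν(x+e_μ) − c(σ(x) − σ(x+e_ν))·R(x,ν)A_μ(x+e_ν)` (the two untransported edges CANCEL EXACTLY);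
  **`comm_comm_covCurl_apply`** (the double commutator: the same with SQUARED increments); **`sum_comm_comm_covCurl_apply`** (a finite family `σ_j`:
  the coefficients are `c·Σ_j(σ_j(x) − σ_j(x+e))²`).
* §2 POINTWISE SIZES (`RCLike 𝕜`, real cutoffs `χ`, transporters `‖R(b)v‖ ≤ M_T‖v‖`): `norm_comm_covCurl_apply_le` (`|χ(b₋) − χ(b₊)| ≤ θ` ⇒
  `≤ ‖c‖θM_T·Σ_{e⊂∂p}‖A(e)‖`), `sum_norm_sq_comm_covCurl_apply_le` (`Σ_j(χ_j(b₋) − χ_j(b₊))² ≤ Θ₂` ⇒ `Σ_j ‖·‖² ≤ 2(‖c‖M_T)²Θ₂·Σ_{e⊂∂p}‖A(e)‖²`),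
  `norm_sum_comm_comm_covCurl_apply_le` (`≤ ‖c‖M_TΘ₂·Σ_{e⊂∂p}‖A(e)‖`), `norm_covCurl_apply_le_of_transport` (`≤ ‖c‖(1+M_T)·Σ_{e⊂∂p}‖A(e)‖`).
* §3 ON THE WEIGHTED `L²` CARRIERS `BondL2K → PlaqL2K` (`B9Eq310HessianOperator.covCurlL2K 𝕜 c₀ c R`), for ANY maps `χS`, `χE` of the carriers ACTING
  pointwise as the multiplications by `χ(b₋)`, `χ(p.1)` (hypotheses `hS`, `hE` — no operator is defined here): **`norm_comm_covCurlL2K_le`**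
  (`‖χE(DA) − D(χS A)‖ ≤ 4√d·‖c‖θM_T·‖A‖`), **`sum_norm_sq_comm_covCurlL2K_le`** (`Σ_j ‖χE_j(DA) − D(χS_j A)‖² ≤ 8d(‖c‖M_T)²Θ₂·‖A‖²` — the `a₁` letter),
  **`norm_sum_comm_comm_covCurlL2K_le`** (`‖Σ_j ad_j(ad_j D)A‖ ≤ 4√d·‖c‖M_TΘ₂·‖A‖` — the `k₁` letter), `norm_covCurlL2K_le_of_transport`
  (`‖DA‖ ≤ 4√d·‖c‖(1+M_T)·‖A‖` — the `t₁` letter in the `M_T` currency; the tree's `norm_covCurlL2K_le` is the `εR`-currency twin).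
* §4 non-vacuity (a constant cutoff commutes: both sides vanish).  THE `η`-BOOKKEEPING (print's `c = η⁻¹`, unit-scale cutoffs `θ = ℓη`,
  `Θ₂ = Nℓ²η²`: the single commutator and `a₁` are `η`-FREE, `k₁` carries ONE `η`, the PRODUCT `t₁k₁` is `η`-FREE) is read off these letters in the
  sibling `B9Eq3100LeibnizCommutatorEtaFree` (same seat), together with the divergence.
HONEST SCOPE.  Exact Leibniz algebra and crude counting on the chain's OWN curl; the cutoffs `χ_j` and their two displayed facts (unit-scale Lipschitz
bound, overlap bound) are HYPOTHESES (no partition of unity is constructed — FREEZE e34b3e0c (0)); constants crude (`4√d` where `√(2(d−1))` would do);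
the letters for `D*` (divergence, row L4) and for `√a·Q̃′` (row L5, NE9 leaf-05's files) are NOT here; NO estimate of [B9] ((3.89)'s `O(M⁻¹)e^{−δ₀d}`
is print's, about Green's functions — not claimed); rows of ONE sub-step of a route step, NOT NE9 (cell pub-balaban: NE9 NOT PRINTED ∕ NOT PROVED;
«NE9 ⇐ the named binders»; row WALLED ON A MODEL (O-NE9-1); spine PROVED 0∕9; rung (B)+1 on a finite T⁴ — NOT infinite volume, NOT mass gap, NOT Clay;
HONEST DEPENDENCY: continuum YM on T⁴ ⇐ BetaPertH ∧ nine spine estimates (0/9 proved); BetaPertH ⇐ (D1) ∧ (D4) ∧ CAP+tail; G-an2-4 gates asym, D1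
and NE2/3/4).  NEW file importing `B9Eq373DerivativeRemainderL2` only; nothing modified.  Net new unproved facts: 0.
-/

noncomputable section

open scoped InnerProductSpace ComplexConjugate BigOperators
open Finset

namespace Literature.MathematicalPhysics.QuantumFieldTheory.Balaban1983to89.B9Eq3100LeibnizCommutatorCurl

open B9SectCLatticeCarrier (Bond DirPair Plaq shift bpos btgt)
open B4Sect5Torus (TSite)
open B9Eq311L2Pairing (WL2)
open B11Eq103H1Complex (BondL2K)
open B9Eq310HessianOperator (PlaqL2K covCurlL2K equiv_covCurlL2K)
open B9Eq34CovCurlVector (covCurl covCurl_apply_coord)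
open B9Ineq369CurvatureSmall (edgeBond)
open B9Eq373DerivativeRemainderL2 (norm_le_of_sum_sq_le sum_plaq_edge_le norm_plaq_le_of_edge_bound)

/-! ## §1 (3.100) for the curl: the commutator with a multiplication is a multiplication by the bond increments on the transported edges -/

section Identity

variable {𝕜 : Type*} [CommRing 𝕜] {d : ℕ} {Pd : Fin d → ℕ} {W : Type*} [AddCommGroup W] [Module 𝕜 W]

/-- **(3.100) FOR THE CURL — THE SINGLE COMMUTATOR IS A MULTIPLICATION LETTER.**  For ANY scalar site function `σ` (acting on bond functions by
`σ(b₋)` and on plaquette functions by `σ` at the base point), any scalar `c` and any linear transporters: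
`σ(x)·(DA)(p_{μν}(x)) − (D(σ̃A))(p_{μν}(x)) = c(σ(x) − σ(x+e_μ))·R(x,μ)A_ν(x+e_μ) − c(σ(x) − σ(x+e_ν))·R(x,ν)A_μ(x+e_ν)` — the two untransported
edges `A_ν(x)`, `A_μ(x)` cancel exactly. [folklore] (Leibniz rule) [cite: Balaban1985BackgroundPropagators, (3.100) p.413, (3.4) p.391] -/
theorem comm_covCurl_apply (σ : TSite d Pd → 𝕜) (c : 𝕜) (R : Bond d Pd → W →ₗ[𝕜] W) (A : Bond d Pd → W) (x : TSite d Pd) (q : DirPair d) :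
    σ x • covCurl c R A (x, q) - covCurl c R (fun b => σ (bpos b) • A b) (x, q) =
      (c * (σ x - σ (shift q.1.1 x))) • R (x, q.1.1) (A (shift q.1.1 x, q.1.2)) -
        (c * (σ x - σ (shift q.1.2 x))) • R (x, q.1.2) (A (shift q.1.2 x, q.1.1)) := by
  simp only [covCurl_apply_coord, bpos, map_smul]
  module

/-- **THE DOUBLE COMMUTATOR IS THE MULTIPLICATION BY THE SQUARED INCREMENTS**:
`σ(x)·([σ,D]A)(p) − ([σ,D](σ̃A))(p) = c(σ(x) − σ(x+e_μ))²·R(x,μ)A_ν(x+e_μ) − c(σ(x) − σ(x+e_ν))²·R(x,ν)A_μ(x+e_ν)`. [folklore] (Leibniz rule, iterated)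
[cite: Balaban1985BackgroundPropagators, (3.100) p.413, p.414 «O(M⁻²)»] -/
theorem comm_comm_covCurl_apply (σ : TSite d Pd → 𝕜) (c : 𝕜) (R : Bond d Pd → W →ₗ[𝕜] W) (A : Bond d Pd → W) (x : TSite d Pd)
    (q : DirPair d) :
    σ x • (σ x • covCurl c R A (x, q) - covCurl c R (fun b => σ (bpos b) • A b) (x, q)) -
        (σ x • covCurl c R (fun b => σ (bpos b) • A b) (x, q) - covCurl c R (fun b => σ (bpos b) • (σ (bpos b) • A b)) (x, q)) =
      (c * (σ x - σ (shift q.1.1 x)) ^ 2) • R (x, q.1.1) (A (shift q.1.1 x, q.1.2)) -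
        (c * (σ x - σ (shift q.1.2 x)) ^ 2) • R (x, q.1.2) (A (shift q.1.2 x, q.1.1)) := by
  simp only [covCurl_apply_coord, bpos, map_smul]
  module

/-- **A FINITE FAMILY OF CUTOFFS**: `Σ_j (σ_j(x)·([σ_j,D]A)(p) − ([σ_j,D](σ̃_jA))(p)) = (c·Σ_j(σ_j(x) − σ_j(x+e_μ))²)·R(x,μ)A_ν(x+e_μ) −
(c·Σ_j(σ_j(x) − σ_j(x+e_ν))²)·R(x,ν)A_μ(x+e_ν)` — the operator `K = Σ_j ad_j(ad_j D)` of the IMS identity is a multiplication letter too. [folklore]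
[cite: Balaban1985BackgroundPropagators, (3.100) p.413, p.408 «Σ h²_□ = 1»] -/
theorem sum_comm_comm_covCurl_apply {J : Type*} (s : Finset J) (σ : J → TSite d Pd → 𝕜) (c : 𝕜) (R : Bond d Pd → W →ₗ[𝕜] W)
    (A : Bond d Pd → W) (x : TSite d Pd) (q : DirPair d) :
    ∑ j ∈ s, (σ j x • (σ j x • covCurl c R A (x, q) - covCurl c R (fun b => σ j (bpos b) • A b) (x, q)) -
        (σ j x • covCurl c R (fun b => σ j (bpos b) • A b) (x, q) - covCurl c R (fun b => σ j (bpos b) • (σ j (bpos b) • A b)) (x, q))) =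
      (c * ∑ j ∈ s, (σ j x - σ j (shift q.1.1 x)) ^ 2) • R (x, q.1.1) (A (shift q.1.1 x, q.1.2)) -
        (c * ∑ j ∈ s, (σ j x - σ j (shift q.1.2 x)) ^ 2) • R (x, q.1.2) (A (shift q.1.2 x, q.1.1)) := by
  simp only [comm_comm_covCurl_apply, Finset.sum_sub_distrib, ← Finset.sum_smul, ← Finset.mul_sum]

end Identity

/-! ## §2 Pointwise sizes: real cutoffs with bounded bond increments, bounded transporters -/

section Pointwise

variable {𝕜 : Type*} [RCLike 𝕜] {d : ℕ} {Pd : Fin d → ℕ} {W : Type*} [NormedAddCommGroup W] [NormedSpace 𝕜 W]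
  {R : Bond d Pd → W →ₗ[𝕜] W} {MT : ℝ}

omit [NormedSpace 𝕜 W] in
/-- the edge sum of a plaquette, unfolded (`B9Ineq369CurvatureSmall.edgeBond`: edges `0` and `3` are the transported ones). [folklore]
[cite: Balaban1985BackgroundPropagators, (3.4) p.391] -/
private theorem edgeSum_eq (A : Bond d Pd → W) (x : TSite d Pd) (q : DirPair d) :
    ∑ k : Fin 4, ‖A (edgeBond ((x, q) : Plaq d Pd) k)‖ =
      ‖A (shift q.1.2 x, q.1.1)‖ + ‖A (x, q.1.2)‖ + ‖A (x, q.1.1)‖ + ‖A (shift q.1.1 x, q.1.2)‖ := by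
  simp only [Fin.sum_univ_four, edgeBond, Matrix.cons_val_zero, Matrix.cons_val_one, Matrix.cons_val]

omit [NormedSpace 𝕜 W] in
/-- the squared edge sum, unfolded. [folklore] [cite: Balaban1985BackgroundPropagators, (3.4) p.391] -/
private theorem edgeSumSq_eq (A : Bond d Pd → W) (x : TSite d Pd) (q : DirPair d) :
    ∑ k : Fin 4, ‖A (edgeBond ((x, q) : Plaq d Pd) k)‖ ^ 2 =
      ‖A (shift q.1.2 x, q.1.1)‖ ^ 2 + ‖A (x, q.1.2)‖ ^ 2 + ‖A (x, q.1.1)‖ ^ 2 + ‖A (shift q.1.1 x, q.1.2)‖ ^ 2 := by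
  simp only [Fin.sum_univ_four, edgeBond, Matrix.cons_val_zero, Matrix.cons_val_one, Matrix.cons_val]

/-- one multiplication-letter term: `‖(c·u)·R(b)v‖ ≤ ‖c‖θM_T‖v‖` when `|u| ≤ θ`. [folklore] [cite: Balaban1985BackgroundPropagators, (3.100) p.413] -/
private theorem norm_term_le (hR : ∀ b v, ‖R b v‖ ≤ MT * ‖v‖) (c : 𝕜) {u θ : ℝ} (hu : |u| ≤ θ) (b : Bond d Pd) (v : W) :
    ‖(c * (u : 𝕜)) • R b v‖ ≤ ‖c‖ * θ * MT * ‖v‖ := by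
  rw [norm_smul, norm_mul, RCLike.norm_ofReal]
  calc ‖c‖ * |u| * ‖R b v‖ ≤ ‖c‖ * θ * (MT * ‖v‖) :=
        mul_le_mul (mul_le_mul_of_nonneg_left hu (norm_nonneg c)) (hR b v) (norm_nonneg _)
          (mul_nonneg (norm_nonneg c) ((abs_nonneg u).trans hu))
    _ = ‖c‖ * θ * MT * ‖v‖ := by ring

/-- **POINTWISE SIZE OF THE SINGLE COMMUTATOR**: bond increments `|χ(b₋) − χ(b₊)| ≤ θ` and transporters `‖R(b)v‖ ≤ M_T‖v‖` give
`‖χ(x)·(DA)(p) − (D(χ̃A))(p)‖ ≤ ‖c‖θM_T·Σ_{e⊂∂p}‖A(e)‖`. [folklore] [cite: Balaban1985BackgroundPropagators, (3.100) p.413, p.414 «O(M⁻¹)»] -/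
theorem norm_comm_covCurl_apply_le (hR : ∀ b v, ‖R b v‖ ≤ MT * ‖v‖) {χ : TSite d Pd → ℝ} {θ : ℝ}
    (hχ : ∀ b : Bond d Pd, |χ (bpos b) - χ (btgt b)| ≤ θ) (c : 𝕜) (A : Bond d Pd → W) (p : Plaq d Pd) :
    ‖(χ p.1 : 𝕜) • covCurl c R A p - covCurl c R (fun b => (χ (bpos b) : 𝕜) • A b) p‖ ≤
      ‖c‖ * θ * MT * ∑ k : Fin 4, ‖A (edgeBond p k)‖ := by
  obtain ⟨x, q⟩ := p
  have hθ : 0 ≤ θ := (abs_nonneg _).trans (hχ (x, q.1.1))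
  have h0 : 0 ≤ ‖c‖ * θ * MT * ‖A (x, q.1.2)‖ + ‖c‖ * θ * MT * ‖A (x, q.1.1)‖ := by
    have h1 := norm_term_le hR c (hχ (x, q.1.1)) (x, q.1.1) (A (x, q.1.2))
    have h2 := norm_term_le hR c (hχ (x, q.1.1)) (x, q.1.1) (A (x, q.1.1))
    exact add_nonneg ((norm_nonneg _).trans h1) ((norm_nonneg _).trans h2)
  rw [comm_covCurl_apply (fun y => (χ y : 𝕜)) c R A x q, edgeSum_eq]
  simp only [← RCLike.ofReal_sub]
  calc ‖(c * ((χ x - χ (shift q.1.1 x) : ℝ) : 𝕜)) • R (x, q.1.1) (A (shift q.1.1 x, q.1.2)) -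
          (c * ((χ x - χ (shift q.1.2 x) : ℝ) : 𝕜)) • R (x, q.1.2) (A (shift q.1.2 x, q.1.1))‖
      ≤ ‖c‖ * θ * MT * ‖A (shift q.1.1 x, q.1.2)‖ + ‖c‖ * θ * MT * ‖A (shift q.1.2 x, q.1.1)‖ :=
        (norm_sub_le _ _).trans (add_le_add (norm_term_le hR c (hχ (x, q.1.1)) _ _) (norm_term_le hR c (hχ (x, q.1.2)) _ _))
    _ ≤ ‖c‖ * θ * MT * (‖A (shift q.1.2 x, q.1.1)‖ + ‖A (x, q.1.2)‖ + ‖A (x, q.1.1)‖ + ‖A (shift q.1.1 x, q.1.2)‖) := by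
        nlinarith [h0]

/-- **POINTWISE FIRST-ORDER SQUARE OF A FAMILY**: `Σ_j(χ_j(b₋) − χ_j(b₊))² ≤ Θ₂` on every bond gives
`Σ_j ‖χ_j(x)·(DA)(p) − (D(χ̃_jA))(p)‖² ≤ 2(‖c‖M_T)²Θ₂·Σ_{e⊂∂p}‖A(e)‖²`. [folklore] [cite: Balaban1985BackgroundPropagators, (3.100) p.413, p.408 «Σ h²_□ = 1»] -/
theorem sum_norm_sq_comm_covCurl_apply_le (hR : ∀ b v, ‖R b v‖ ≤ MT * ‖v‖) {J : Type*} (s : Finset J)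
    {χ : J → TSite d Pd → ℝ} {Θ₂ : ℝ} (hχ : ∀ b : Bond d Pd, ∑ j ∈ s, (χ j (bpos b) - χ j (btgt b)) ^ 2 ≤ Θ₂) (c : 𝕜) (A : Bond d Pd → W)
    (p : Plaq d Pd) :
    ∑ j ∈ s, ‖(χ j p.1 : 𝕜) • covCurl c R A p - covCurl c R (fun b => (χ j (bpos b) : 𝕜) • A b) p‖ ^ 2 ≤
      2 * (‖c‖ * MT) ^ 2 * Θ₂ * ∑ k : Fin 4, ‖A (edgeBond p k)‖ ^ 2 := by
  obtain ⟨x, q⟩ := p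
  -- each term: ‖u − v‖² ≤ 2‖u‖² + 2‖v‖², ‖u‖ ≤ ‖c‖·|δ¹|·M_T‖A₁‖, ‖v‖ ≤ ‖c‖·|δ²|·M_T‖A₂‖
  have hpt : ∀ j ∈ s, ‖(χ j x : 𝕜) • covCurl c R A (x, q) - covCurl c R (fun b => (χ j (bpos b) : 𝕜) • A b) (x, q)‖ ^ 2 ≤
      2 * (‖c‖ * MT) ^ 2 * ((χ j x - χ j (shift q.1.1 x)) ^ 2 * ‖A (shift q.1.1 x, q.1.2)‖ ^ 2 +
        (χ j x - χ j (shift q.1.2 x)) ^ 2 * ‖A (shift q.1.2 x, q.1.1)‖ ^ 2) := fun j _ => by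
    rw [comm_covCurl_apply (fun y => (χ j y : 𝕜)) c R A x q]
    simp only [← RCLike.ofReal_sub]
    obtain ⟨U, hU⟩ : ∃ U : W, U = (c * ((χ j x - χ j (shift q.1.1 x) : ℝ) : 𝕜)) • R (x, q.1.1) (A (shift q.1.1 x, q.1.2)) := ⟨_, rfl⟩
    obtain ⟨V, hV⟩ : ∃ V : W, V = (c * ((χ j x - χ j (shift q.1.2 x) : ℝ) : 𝕜)) • R (x, q.1.2) (A (shift q.1.2 x, q.1.1)) := ⟨_, rfl⟩
    have h1 := norm_term_le hR c (le_refl |χ j x - χ j (shift q.1.1 x)|) (x, q.1.1) (A (shift q.1.1 x, q.1.2))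
    have h2 := norm_term_le hR c (le_refl |χ j x - χ j (shift q.1.2 x)|) (x, q.1.2) (A (shift q.1.2 x, q.1.1))
    rw [← hU] at h1 ⊢
    rw [← hV] at h2 ⊢
    have e1 : (‖c‖ * |χ j x - χ j (shift q.1.1 x)| * MT * ‖A (shift q.1.1 x, q.1.2)‖) ^ 2 =
        (‖c‖ * MT) ^ 2 * ((χ j x - χ j (shift q.1.1 x)) ^ 2 * ‖A (shift q.1.1 x, q.1.2)‖ ^ 2) := by rw [← sq_abs (χ j x - _)]; ring
    have e2 : (‖c‖ * |χ j x - χ j (shift q.1.2 x)| * MT * ‖A (shift q.1.2 x, q.1.1)‖) ^ 2 =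
        (‖c‖ * MT) ^ 2 * ((χ j x - χ j (shift q.1.2 x)) ^ 2 * ‖A (shift q.1.2 x, q.1.1)‖ ^ 2) := by rw [← sq_abs (χ j x - _)]; ring
    have hu := pow_le_pow_left₀ (norm_nonneg _) h1 2
    have hv := pow_le_pow_left₀ (norm_nonneg _) h2 2
    rw [e1] at hu; rw [e2] at hv
    have hsq : ‖U - V‖ ^ 2 ≤ 2 * ‖U‖ ^ 2 + 2 * ‖V‖ ^ 2 := by
      nlinarith [pow_le_pow_left₀ (norm_nonneg _) (norm_sub_le U V) 2, sq_nonneg (‖U‖ - ‖V‖), norm_nonneg U, norm_nonneg V]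
    linarith
  have hΘ1 := hχ (x, q.1.1)
  have hΘ2 := hχ (x, q.1.2)
  simp only [bpos, btgt] at hΘ1 hΘ2
  refine (sum_le_sum hpt).trans ?_
  rw [← mul_sum, sum_add_distrib, ← sum_mul, ← sum_mul, edgeSumSq_eq]
  have hc : 0 ≤ (‖c‖ * MT) ^ 2 := sq_nonneg _
  have hA1 := sq_nonneg ‖A (shift q.1.1 x, q.1.2)‖
  have hA2 := sq_nonneg ‖A (shift q.1.2 x, q.1.1)‖
  have hΘ0 : 0 ≤ Θ₂ := le_trans (sum_nonneg fun j _ => sq_nonneg _) hΘ1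
  have h1 : (∑ j ∈ s, (χ j x - χ j (shift q.1.1 x)) ^ 2) * ‖A (shift q.1.1 x, q.1.2)‖ ^ 2 ≤ Θ₂ * ‖A (shift q.1.1 x, q.1.2)‖ ^ 2 :=
    mul_le_mul_of_nonneg_right hΘ1 hA1
  have h2 : (∑ j ∈ s, (χ j x - χ j (shift q.1.2 x)) ^ 2) * ‖A (shift q.1.2 x, q.1.1)‖ ^ 2 ≤ Θ₂ * ‖A (shift q.1.2 x, q.1.1)‖ ^ 2 :=
    mul_le_mul_of_nonneg_right hΘ2 hA2
  have h3 : 0 ≤ (‖c‖ * MT) ^ 2 * Θ₂ * (‖A (x, q.1.2)‖ ^ 2 + ‖A (x, q.1.1)‖ ^ 2) := by positivity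
  have h4 := mul_le_mul_of_nonneg_left (add_le_add h1 h2) hc
  nlinarith [h3, h4]

/-- **POINTWISE SIZE OF THE DOUBLE-COMMUTATOR SUM `K₁ = Σ_j ad_j(ad_j D)`**: `‖Σ_j(χ_j(x)·([χ_j,D]A)(p) − ([χ_j,D](χ̃_jA))(p))‖ ≤ ‖c‖M_TΘ₂·Σ_{e⊂∂p}‖A(e)‖`.
[folklore] [cite: Balaban1985BackgroundPropagators, (3.100) p.413, p.414 «O(M⁻²)»] -/
theorem norm_sum_comm_comm_covCurl_apply_le (hR : ∀ b v, ‖R b v‖ ≤ MT * ‖v‖) {J : Type*} (s : Finset J)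
    {χ : J → TSite d Pd → ℝ} {Θ₂ : ℝ} (hχ : ∀ b : Bond d Pd, ∑ j ∈ s, (χ j (bpos b) - χ j (btgt b)) ^ 2 ≤ Θ₂) (c : 𝕜) (A : Bond d Pd → W)
    (p : Plaq d Pd) :
    ‖∑ j ∈ s, ((χ j p.1 : 𝕜) • ((χ j p.1 : 𝕜) • covCurl c R A p - covCurl c R (fun b => (χ j (bpos b) : 𝕜) • A b) p) -
        ((χ j p.1 : 𝕜) • covCurl c R (fun b => (χ j (bpos b) : 𝕜) • A b) p -
          covCurl c R (fun b => (χ j (bpos b) : 𝕜) • ((χ j (bpos b) : 𝕜) • A b)) p))‖ ≤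
      ‖c‖ * Θ₂ * MT * ∑ k : Fin 4, ‖A (edgeBond p k)‖ := by
  obtain ⟨x, q⟩ := p
  have hΘ1 := hχ (x, q.1.1)
  have hΘ2 := hχ (x, q.1.2)
  simp only [bpos, btgt] at hΘ1 hΘ2
  have hΘ0 : 0 ≤ Θ₂ := le_trans (sum_nonneg fun j _ => sq_nonneg _) hΘ1
  have habs1 : |∑ j ∈ s, (χ j x - χ j (shift q.1.1 x)) ^ 2| ≤ Θ₂ := by rwa [abs_of_nonneg (sum_nonneg fun j _ => sq_nonneg _)]
  have habs2 : |∑ j ∈ s, (χ j x - χ j (shift q.1.2 x)) ^ 2| ≤ Θ₂ := by rwa [abs_of_nonneg (sum_nonneg fun j _ => sq_nonneg _)]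
  rw [sum_comm_comm_covCurl_apply s (fun j y => (χ j y : 𝕜)) c R A x q, edgeSum_eq]
  simp only [← RCLike.ofReal_sub, ← RCLike.ofReal_pow, ← RCLike.ofReal_sum]
  have h0 : 0 ≤ ‖c‖ * Θ₂ * MT * ‖A (x, q.1.2)‖ + ‖c‖ * Θ₂ * MT * ‖A (x, q.1.1)‖ := by
    have h1 := norm_term_le hR c habs1 (x, q.1.1) (A (x, q.1.2))
    have h2 := norm_term_le hR c habs1 (x, q.1.1) (A (x, q.1.1))
    exact add_nonneg ((norm_nonneg _).trans h1) ((norm_nonneg _).trans h2)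
  calc ‖(c * ((∑ j ∈ s, (χ j x - χ j (shift q.1.1 x)) ^ 2 : ℝ) : 𝕜)) • R (x, q.1.1) (A (shift q.1.1 x, q.1.2)) -
          (c * ((∑ j ∈ s, (χ j x - χ j (shift q.1.2 x)) ^ 2 : ℝ) : 𝕜)) • R (x, q.1.2) (A (shift q.1.2 x, q.1.1))‖
      ≤ ‖c‖ * Θ₂ * MT * ‖A (shift q.1.1 x, q.1.2)‖ + ‖c‖ * Θ₂ * MT * ‖A (shift q.1.2 x, q.1.1)‖ :=
        (norm_sub_le _ _).trans (add_le_add (norm_term_le hR c habs1 _ _) (norm_term_le hR c habs2 _ _))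
    _ ≤ ‖c‖ * Θ₂ * MT * (‖A (shift q.1.2 x, q.1.1)‖ + ‖A (x, q.1.2)‖ + ‖A (x, q.1.1)‖ + ‖A (shift q.1.1 x, q.1.2)‖) := by
        nlinarith [h0]

/-- **POINTWISE SIZE OF THE CURL ITSELF IN THE `M_T` CURRENCY**: `‖(DA)(p)‖ ≤ ‖c‖(1+M_T)·Σ_{e⊂∂p}‖A(e)‖`. [folklore]
[cite: Balaban1985BackgroundPropagators, (3.4) p.391] -/
theorem norm_covCurl_apply_le_of_transport (hMT : 0 ≤ MT) (hR : ∀ b v, ‖R b v‖ ≤ MT * ‖v‖) (c : 𝕜) (A : Bond d Pd → W)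
    (p : Plaq d Pd) : ‖covCurl c R A p‖ ≤ ‖c‖ * (1 + MT) * ∑ k : Fin 4, ‖A (edgeBond p k)‖ := by
  obtain ⟨x, q⟩ := p
  rw [covCurl_apply_coord, edgeSum_eq]
  have h3 := hR (x, q.1.1) (A (shift q.1.1 x, q.1.2))
  have h0 := hR (x, q.1.2) (A (shift q.1.2 x, q.1.1))
  have hc0 := norm_nonneg c
  calc ‖c • (R (x, q.1.1) (A (shift q.1.1 x, q.1.2)) - A (x, q.1.2)) - c • (R (x, q.1.2) (A (shift q.1.2 x, q.1.1)) - A (x, q.1.1))‖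
      ≤ ‖c‖ * (‖R (x, q.1.1) (A (shift q.1.1 x, q.1.2))‖ + ‖A (x, q.1.2)‖) + ‖c‖ * (‖R (x, q.1.2) (A (shift q.1.2 x, q.1.1))‖ + ‖A (x, q.1.1)‖) := by
        refine (norm_sub_le _ _).trans (add_le_add ?_ ?_) <;> rw [norm_smul] <;>
          exact mul_le_mul_of_nonneg_left (norm_sub_le _ _) hc0
    _ ≤ ‖c‖ * (1 + MT) * (‖A (shift q.1.2 x, q.1.1)‖ + ‖A (x, q.1.2)‖ + ‖A (x, q.1.1)‖ + ‖A (shift q.1.1 x, q.1.2)‖) := by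
        nlinarith [mul_le_mul_of_nonneg_left (add_le_add h3 h0) hc0, norm_nonneg (A (x, q.1.2)), norm_nonneg (A (x, q.1.1)),
          norm_nonneg (A (shift q.1.1 x, q.1.2)), norm_nonneg (A (shift q.1.2 x, q.1.1)), mul_nonneg hc0 hMT]

end Pointwise

/-! ## §3 The letters on the weighted `L²` carriers `BondL2K → PlaqL2K`, for any maps acting as the multiplications -/

section L2

variable {𝕜 : Type*} [RCLike 𝕜] {d : ℕ} {Pd : Fin d → ℕ} {W : Type*} [NormedAddCommGroup W] [InnerProductSpace 𝕜 W]
  {c₀ : ℝ} [Fact (0 < c₀)] {R : Bond d Pd → W →ₗ[𝕜] W} {MT : ℝ}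

omit [RCLike 𝕜] [InnerProductSpace 𝕜 W] in
/-- a finite sum of carrier elements evaluates pointwise (the carrier is a type synonym of the functions). [folklore]
[cite: Balaban1985BackgroundPropagators, (3.11) p.392] -/
private theorem equiv_sum {X : Type*} {w : X → ℝ} {J : Type*} (s : Finset J) (f : J → WL2 𝕜 w W) (x : X) :
    WL2.equiv 𝕜 w W (∑ j ∈ s, f j) x = ∑ j ∈ s, WL2.equiv 𝕜 w W (f j) x := by
  induction s using Finset.cons_induction with
  | empty => simp
  | cons a s h ih => rw [Finset.sum_cons, Finset.sum_cons, WL2.equiv_add, Pi.add_apply, ih]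

variable (χS : BondL2K 𝕜 d Pd c₀ W → BondL2K 𝕜 d Pd c₀ W) (χE : PlaqL2K 𝕜 d Pd c₀ W → PlaqL2K 𝕜 d Pd c₀ W) {χ : TSite d Pd → ℝ}

/-- reading the commutator element through the identification. [folklore] [cite: Balaban1985BackgroundPropagators, (3.100) p.413] -/
private theorem equiv_comm (hS : ∀ (A : BondL2K 𝕜 d Pd c₀ W) (b : Bond d Pd), WL2.equiv 𝕜 _ W (χS A) b = (χ (bpos b) : 𝕜) • WL2.equiv 𝕜 _ W A b)
    (hE : ∀ (G : PlaqL2K 𝕜 d Pd c₀ W) (p : Plaq d Pd), WL2.equiv 𝕜 _ W (χE G) p = (χ p.1 : 𝕜) • WL2.equiv 𝕜 _ W G p) (c : 𝕜)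
    (A : BondL2K 𝕜 d Pd c₀ W) (p : Plaq d Pd) :
    WL2.equiv 𝕜 _ W (χE (covCurlL2K 𝕜 c₀ c R A) - covCurlL2K 𝕜 c₀ c R (χS A)) p =
      (χ p.1 : 𝕜) • covCurl c R (WL2.equiv 𝕜 _ W A) p - covCurl c R (fun b => (χ (bpos b) : 𝕜) • WL2.equiv 𝕜 _ W A b) p := by
  have hSA : WL2.equiv 𝕜 _ W (χS A) = fun b => (χ (bpos b) : 𝕜) • WL2.equiv 𝕜 _ W A b := funext (hS A)
  rw [WL2.equiv_sub, Pi.sub_apply, hE, equiv_covCurlL2K, equiv_covCurlL2K, hSA]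

/-- **THE SINGLE-COMMUTATOR LETTER ON `L²`** (row L6 for `T₁ = D_U`): for ANY maps `χS` of the bond carrier and `χE` of the plaquette carrier
acting pointwise as the multiplications by `χ(b₋)`, `χ(p.1)` (hypotheses `hS`, `hE`), bond increments `|χ(b₋) − χ(b₊)| ≤ θ` (`0 ≤ θ`), transporters
`‖R(b)v‖ ≤ M_T‖v‖` (`0 ≤ M_T`): `‖χE(DA) − D(χS A)‖ ≤ 4√d·‖c‖θM_T·‖A‖`. [folklore] [cite: Balaban1985BackgroundPropagators, (3.100) p.413, p.414 «O(M⁻¹)», (3.11) p.392] -/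
theorem norm_comm_covCurlL2K_le (hMT : 0 ≤ MT) (hR : ∀ b v, ‖R b v‖ ≤ MT * ‖v‖) {θ : ℝ} (hθ : 0 ≤ θ)
    (hχ : ∀ b : Bond d Pd, |χ (bpos b) - χ (btgt b)| ≤ θ)
    (hS : ∀ (A : BondL2K 𝕜 d Pd c₀ W) (b : Bond d Pd), WL2.equiv 𝕜 _ W (χS A) b = (χ (bpos b) : 𝕜) • WL2.equiv 𝕜 _ W A b)
    (hE : ∀ (G : PlaqL2K 𝕜 d Pd c₀ W) (p : Plaq d Pd), WL2.equiv 𝕜 _ W (χE G) p = (χ p.1 : 𝕜) • WL2.equiv 𝕜 _ W G p) (c : 𝕜)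
    (A : BondL2K 𝕜 d Pd c₀ W) :
    ‖χE (covCurlL2K 𝕜 c₀ c R A) - covCurlL2K 𝕜 c₀ c R (χS A)‖ ≤ 4 * Real.sqrt d * (‖c‖ * θ * MT) * ‖A‖ :=
  norm_plaq_le_of_edge_bound A _ (by positivity) fun p => by
    rw [equiv_comm χS χE hS hE]
    exact norm_comm_covCurl_apply_le hR hχ c _ p

/-- **THE FIRST-ORDER SQUARE `a₁` OF A FAMILY ON `L²`** (kernel 7's `Σ_j ‖AD_1j x‖² ≤ a₁‖x‖²` for `T₁ = D_U`): maps `χS_j`, `χE_j` acting as the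
multiplications by `χ_j(b₋)`, `χ_j(p.1)`, overlap bound `Σ_j(χ_j(b₋) − χ_j(b₊))² ≤ Θ₂` on every bond, transporters `‖R(b)v‖ ≤ M_T‖v‖`:
`Σ_j ‖χE_j(DA) − D(χS_j A)‖² ≤ 8d(‖c‖M_T)²Θ₂·‖A‖²`. [folklore] [cite: Balaban1985BackgroundPropagators, (3.100) p.413, p.408 «Σ h²_□ = 1», (3.11) p.392] -/
theorem sum_norm_sq_comm_covCurlL2K_le (hR : ∀ b v, ‖R b v‖ ≤ MT * ‖v‖) {J : Type*} (s : Finset J)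
    {χf : J → TSite d Pd → ℝ} {Θ₂ : ℝ} (hΘ : 0 ≤ Θ₂) (hχ : ∀ b : Bond d Pd, ∑ j ∈ s, (χf j (bpos b) - χf j (btgt b)) ^ 2 ≤ Θ₂)
    (χSf : J → BondL2K 𝕜 d Pd c₀ W → BondL2K 𝕜 d Pd c₀ W) (χEf : J → PlaqL2K 𝕜 d Pd c₀ W → PlaqL2K 𝕜 d Pd c₀ W)
    (hS : ∀ j (A : BondL2K 𝕜 d Pd c₀ W) (b : Bond d Pd), WL2.equiv 𝕜 _ W (χSf j A) b = (χf j (bpos b) : 𝕜) • WL2.equiv 𝕜 _ W A b)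
    (hE : ∀ j (G : PlaqL2K 𝕜 d Pd c₀ W) (p : Plaq d Pd), WL2.equiv 𝕜 _ W (χEf j G) p = (χf j p.1 : 𝕜) • WL2.equiv 𝕜 _ W G p) (c : 𝕜)
    (A : BondL2K 𝕜 d Pd c₀ W) :
    ∑ j ∈ s, ‖χEf j (covCurlL2K 𝕜 c₀ c R A) - covCurlL2K 𝕜 c₀ c R (χSf j A)‖ ^ 2 ≤ 8 * d * (‖c‖ * MT) ^ 2 * Θ₂ * ‖A‖ ^ 2 := by
  have hc₀ : 0 < c₀ := Fact.out
  set a : Bond d Pd → W := WL2.equiv 𝕜 _ W A with ha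
  -- each norm square is a weighted sum over plaquettes; exchange the sums
  have hsq : ∀ j ∈ s, ‖χEf j (covCurlL2K 𝕜 c₀ c R A) - covCurlL2K 𝕜 c₀ c R (χSf j A)‖ ^ 2 =
      ∑ p : Plaq d Pd, c₀ * ‖(χf j p.1 : 𝕜) • covCurl c R a p - covCurl c R (fun b => (χf j (bpos b) : 𝕜) • a b) p‖ ^ 2 := fun j _ => by
    rw [WL2.norm_sq]
    exact sum_congr rfl fun p _ => by rw [equiv_comm (χSf j) (χEf j) (hS j) (hE j)]
  rw [sum_congr rfl hsq, sum_comm]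
  -- pointwise family bound, then the edge count
  have hpt : ∀ p : Plaq d Pd, ∑ j ∈ s, c₀ * ‖(χf j p.1 : 𝕜) • covCurl c R a p - covCurl c R (fun b => (χf j (bpos b) : 𝕜) • a b) p‖ ^ 2 ≤
      2 * (‖c‖ * MT) ^ 2 * Θ₂ * ∑ k : Fin 4, c₀ * ‖a (edgeBond p k)‖ ^ 2 := fun p => by
    rw [← mul_sum, ← mul_sum, mul_left_comm]
    exact mul_le_mul_of_nonneg_left (sum_norm_sq_comm_covCurl_apply_le hR s hχ c a p) hc₀.le
  calc ∑ p : Plaq d Pd, ∑ j ∈ s, c₀ * ‖(χf j p.1 : 𝕜) • covCurl c R a p - covCurl c R (fun b => (χf j (bpos b) : 𝕜) • a b) p‖ ^ 2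
      ≤ ∑ p : Plaq d Pd, 2 * (‖c‖ * MT) ^ 2 * Θ₂ * ∑ k : Fin 4, c₀ * ‖a (edgeBond p k)‖ ^ 2 := sum_le_sum fun p _ => hpt p
    _ = 2 * (‖c‖ * MT) ^ 2 * Θ₂ * ∑ p : Plaq d Pd, ∑ k : Fin 4, c₀ * ‖a (edgeBond p k)‖ ^ 2 := by rw [← mul_sum]
    _ ≤ 2 * (‖c‖ * MT) ^ 2 * Θ₂ * (4 * d * ∑ b : Bond d Pd, c₀ * ‖a b‖ ^ 2) := by
        exact mul_le_mul_of_nonneg_left (sum_plaq_edge_le (g := fun b => ‖a b‖ ^ 2) (fun b => sq_nonneg _) hc₀.le) (by positivity)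
    _ = 8 * d * (‖c‖ * MT) ^ 2 * Θ₂ * ‖A‖ ^ 2 := by rw [WL2.norm_sq A]; ring

/-- **THE DOUBLE-COMMUTATOR LETTER `k₁` ON `L²`** (row L7 for `T₁ = D_U`): with the overlap bound `Σ_j(χ_j(b₋) − χ_j(b₊))² ≤ Θ₂` (`0 ≤ Θ₂`),
`‖Σ_j (χE_j(χE_j(DA) − D(χS_j A)) − (χE_j(D(χS_j A)) − D(χS_j(χS_j A))))‖ ≤ 4√d·‖c‖M_TΘ₂·‖A‖` — the element IS `(Σ_j ad_j(ad_j D))A` for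
`ad_j T = χE_j T − T χS_j`. [folklore] [cite: Balaban1985BackgroundPropagators, (3.100) p.413, p.414 «O(M⁻²)», (3.11) p.392] -/
theorem norm_sum_comm_comm_covCurlL2K_le (hMT : 0 ≤ MT) (hR : ∀ b v, ‖R b v‖ ≤ MT * ‖v‖) {J : Type*} (s : Finset J)
    {χf : J → TSite d Pd → ℝ} {Θ₂ : ℝ} (hΘ : 0 ≤ Θ₂) (hχ : ∀ b : Bond d Pd, ∑ j ∈ s, (χf j (bpos b) - χf j (btgt b)) ^ 2 ≤ Θ₂)
    (χSf : J → BondL2K 𝕜 d Pd c₀ W → BondL2K 𝕜 d Pd c₀ W) (χEf : J → PlaqL2K 𝕜 d Pd c₀ W → PlaqL2K 𝕜 d Pd c₀ W)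
    (hS : ∀ j (A : BondL2K 𝕜 d Pd c₀ W) (b : Bond d Pd), WL2.equiv 𝕜 _ W (χSf j A) b = (χf j (bpos b) : 𝕜) • WL2.equiv 𝕜 _ W A b)
    (hE : ∀ j (G : PlaqL2K 𝕜 d Pd c₀ W) (p : Plaq d Pd), WL2.equiv 𝕜 _ W (χEf j G) p = (χf j p.1 : 𝕜) • WL2.equiv 𝕜 _ W G p) (c : 𝕜)
    (A : BondL2K 𝕜 d Pd c₀ W) :
    ‖∑ j ∈ s, (χEf j (χEf j (covCurlL2K 𝕜 c₀ c R A) - covCurlL2K 𝕜 c₀ c R (χSf j A)) -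
        (χEf j (covCurlL2K 𝕜 c₀ c R (χSf j A)) - covCurlL2K 𝕜 c₀ c R (χSf j (χSf j A))))‖ ≤
      4 * Real.sqrt d * (‖c‖ * Θ₂ * MT) * ‖A‖ := by
  refine norm_plaq_le_of_edge_bound A _ (by positivity) fun p => ?_
  have hSA : ∀ j (B : BondL2K 𝕜 d Pd c₀ W), WL2.equiv 𝕜 _ W (χSf j B) = fun b => (χf j (bpos b) : 𝕜) • WL2.equiv 𝕜 _ W B b :=
    fun j B => funext (hS j B)
  have hread : WL2.equiv 𝕜 _ W (∑ j ∈ s, (χEf j (χEf j (covCurlL2K 𝕜 c₀ c R A) - covCurlL2K 𝕜 c₀ c R (χSf j A)) -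
      (χEf j (covCurlL2K 𝕜 c₀ c R (χSf j A)) - covCurlL2K 𝕜 c₀ c R (χSf j (χSf j A))))) p =
      ∑ j ∈ s, ((χf j p.1 : 𝕜) • ((χf j p.1 : 𝕜) • covCurl c R (WL2.equiv 𝕜 _ W A) p -
          covCurl c R (fun b => (χf j (bpos b) : 𝕜) • WL2.equiv 𝕜 _ W A b) p) -
        ((χf j p.1 : 𝕜) • covCurl c R (fun b => (χf j (bpos b) : 𝕜) • WL2.equiv 𝕜 _ W A b) p -
          covCurl c R (fun b => (χf j (bpos b) : 𝕜) • ((χf j (bpos b) : 𝕜) • WL2.equiv 𝕜 _ W A b)) p)) := by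
    rw [equiv_sum]
    refine sum_congr rfl fun j _ => ?_
    have h2 : WL2.equiv 𝕜 _ W (χSf j (χSf j A)) = fun b => (χf j (bpos b) : 𝕜) • ((χf j (bpos b) : 𝕜) • WL2.equiv 𝕜 _ W A b) := by
      rw [hSA j (χSf j A)]; exact funext fun b => by rw [hSA j A]
    rw [WL2.equiv_sub, Pi.sub_apply, hE, WL2.equiv_sub, Pi.sub_apply, hE, WL2.equiv_sub, Pi.sub_apply, hE]
    simp only [equiv_covCurlL2K]
    rw [h2, hSA j A]
  rw [hread]
  exact norm_sum_comm_comm_covCurl_apply_le hR s hχ c _ p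

/-- **THE `t₁` LETTER IN THE `M_T` CURRENCY**: `‖DA‖ ≤ 4√d·‖c‖(1+M_T)·‖A‖` (the tree's `B9Eq373DerivativeRemainderL2.norm_covCurlL2K_le` is the
`εR`-currency twin `4√d(1+εR)‖c‖`). [folklore] [cite: Balaban1985BackgroundPropagators, (3.4) p.391, (3.11) p.392] -/
theorem norm_covCurlL2K_le_of_transport (hMT : 0 ≤ MT) (hR : ∀ b v, ‖R b v‖ ≤ MT * ‖v‖) (c : 𝕜) (A : BondL2K 𝕜 d Pd c₀ W) :
    ‖covCurlL2K 𝕜 c₀ c R A‖ ≤ 4 * Real.sqrt d * (‖c‖ * (1 + MT)) * ‖A‖ :=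
  norm_plaq_le_of_edge_bound A _ (by positivity) fun p => by
    rw [equiv_covCurlL2K]
    exact norm_covCurl_apply_le_of_transport hMT hR c _ p

end L2

/-! ## §4 Non-vacuity: a constant cutoff commutes with the curl -/

section Sanity

/-- With a CONSTANT cutoff both sides of `comm_covCurl_apply` vanish (the hypotheses of §2–§3 hold with `θ = 0`, `Θ₂ = 0`). [folklore] -/
example {d : ℕ} {Pd : Fin d → ℕ} (c r : ℂ) (R : Bond d Pd → ℂ →ₗ[ℂ] ℂ) (A : Bond d Pd → ℂ) (x : TSite d Pd) (q : DirPair d) :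
    r • covCurl c R A (x, q) - covCurl c R (fun b => r • A b) (x, q) = 0 := by
  rw [comm_covCurl_apply (fun _ => r) c R A x q]
  simp

end Sanity

end Literature.MathematicalPhysics.QuantumFieldTheory.Balaban1983to89.B9Eq3100LeibnizCommutatorCurl

end
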